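import Summits.Parity.GeneralizedHardyLittlewood.Theorems.GreenTaoLevelTwoGITwoCyclicInverseBracketArithmetic

/-!
# Route `GreenTaoLevelTwo`, crux `GITwo` (stmt-Parity-21275), line `birth`, stub `stub_cyclicInverse`:
# the elementary factors of GT08a arXiv Lemma 69 as nilsequences read on `ℤ/Nℤ`

Seventieth helper file toward the XL stub `stub_cyclicInverse` (B. Green, T. Tao, *An inverse
theorem for the Gowers `U³(G)` norm*, arXiv:math/0503014, Thm. 68 = PEMS 51 (2008) Thm. 12.8).
Block E17 (arXiv §12): the factors of the function (eq10.111) of the proof of Thm. 68 —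
`χ(ξ·n)`, `χ(ξ·n)e(s{ξ·n})`, `χ²(ξ·n)χ²(ξ'·n)e(s{ξ·n}{ξ'·n})` and (after the splitting of Lemma 69)
`χ(αn)e(P(n) − c n[αn])` — realised as `1`-bounded Lipschitz nilsequences on members of the
Heisenberg class, READ AT `x = n mod N` (`n ∈ ℤ`): the brackets of the algebraic side are
`valMinAbs (n·ξ)` (`…BracketFormFreq`), and `toAddCircle(n·ξ) = ↑(n·valMinAbs ξ/N)` identifies
them with the rotation orbits.  Def-free:

* `toAddCircle_natMul_eq` — `toAddCircle((n : ℤ/N) ξ) = ↑(n · valMinAbs ξ / N)`;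
* `exists_cutoff_factor`, `exists_linear_factor` (circle), `exists_quad_factor` (torus),
  `exists_heis_factor` (Heisenberg, `N` odd) — the four realisations with explicit Lipschitz
  constants.

References: [GreenTao2008U3Inverse] arXiv:math/0503014, §12, Lemma 69 and proof of Thm. 68.
-/

noncomputable section

namespace Summit.Parity.GeneralizedHardyLittlewood.GreenTaoLevelTwoGITwoCyclicInverse

open Literature.NumberTheory.Sieve
open Literature.NumberTheory.Sieve.GreenTaoLevelTwo

/-- `toAddCircle ((n : ℤ/Nℤ) ξ) = ↑(n · valMinAbs ξ / N)`: the Bohr coordinate of `n mod N` is the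
`n`-th point of the rotation by `valMinAbs ξ / N`. [folklore] -/
theorem toAddCircle_intMul_eq {N : ℕ} [NeZero N] (ξ : ZMod N) (n : ℤ) :
    ZMod.toAddCircle ((n : ZMod N) * ξ) =
      (((0 + n * ((ξ.valMinAbs : ℝ) / N) : ℝ)) : AddCircle (1 : ℝ)) := by
  have h1 : (n : ZMod N) * ξ = (((n * ξ.valMinAbs : ℤ)) : ZMod N) := by
    rw [Int.cast_mul, ZMod.coe_valMinAbs]
  rw [h1, ZMod.toAddCircle_intCast]
  congr 1; push_cast; ring

section Circle

variable {N : ℕ} [NeZero N] {κ : AddCircle (1 : ℝ) → ℝ} {r₂ Lκ : ℝ}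

/-- **The cutoff factor `χ(ξ·n)`** as a circle nilsequence: `Φ(gⁿp) = κ(toAddCircle(n ξ))`,
`Φ` `1`-bounded and `L_κ`-Lipschitz. [cite: GreenTao2008U3Inverse, §12, proof of Thm. 68] -/
theorem exists_cutoff_factor (hκ : ∀ a, 0 ≤ κ a ∧ κ a ≤ 1)
    (hκL : ∀ a b, |κ a - κ b| ≤ Lκ * dist a b) (ξ : ZMod N) (h12 : 1 ≤ 2) :
    ∃ (Φ : (Nilmanifold.circle.ofLE h12).G ⧸ (Nilmanifold.circle.ofLE h12).Γ → ℂ)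
      (g : (Nilmanifold.circle.ofLE h12).G)
      (p₀ : (Nilmanifold.circle.ofLE h12).G ⧸ (Nilmanifold.circle.ofLE h12).Γ),
      (∀ y, ‖Φ y‖ ≤ 1) ∧ (∀ y z, ‖Φ y - Φ z‖ ≤ Lκ * (Nilmanifold.circle.ofLE h12).dist y z) ∧
      ∀ n : ℤ, Φ (g ^ n • p₀) = (κ (ZMod.toAddCircle ((n : ZMod N) * ξ)) : ℂ) := by
  obtain ⟨Φ, g, p₀, hb, hL, horb⟩ := exists_circle_realisation (fun a => (κ a : ℂ)) (M := Lκ)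
    (fun a => by
      rw [Complex.norm_real, Real.norm_eq_abs, abs_of_nonneg (hκ a).1]; exact (hκ a).2)
    (fun a b => by rw [← Complex.ofReal_sub, Complex.norm_real, Real.norm_eq_abs]; exact hκL a b)
    ((ξ.valMinAbs : ℝ) / N) 0 h12
  refine ⟨Φ, g, p₀, hb, hL, fun n => ?_⟩
  rw [horb n, toAddCircle_intMul_eq]

/-- **The linear bracket factor `χ(ξ·n) e(s{ξ·n})`** as a circle nilsequence:
`Φ(gⁿp) = κ(toAddCircle(nξ)) · e(s · valMinAbs(nξ)/N)`, `Φ` `1`-bounded and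
`(L_κ + 2π|s| + 2/(½−r₂))`-Lipschitz. [cite: GreenTao2008U3Inverse, §12, Lemma 69] -/
theorem exists_linear_factor (hr : r₂ < 1 / 2) (hκ : ∀ a, 0 ≤ κ a ∧ κ a ≤ 1)
    (hκ0 : ∀ a, r₂ ≤ ‖a‖ → κ a = 0) (hκL : ∀ a b, |κ a - κ b| ≤ Lκ * dist a b) (hLκ : 0 ≤ Lκ)
    (ξ : ZMod N) (s : ℝ) (h12 : 1 ≤ 2) :
    ∃ (Φ : (Nilmanifold.circle.ofLE h12).G ⧸ (Nilmanifold.circle.ofLE h12).Γ → ℂ)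
      (g : (Nilmanifold.circle.ofLE h12).G)
      (p₀ : (Nilmanifold.circle.ofLE h12).G ⧸ (Nilmanifold.circle.ofLE h12).Γ),
      (∀ y, ‖Φ y‖ ≤ 1) ∧
      (∀ y z, ‖Φ y - Φ z‖ ≤
        (Lκ + 2 * Real.pi * |s| + 2 / (1 / 2 - r₂)) * (Nilmanifold.circle.ofLE h12).dist y z) ∧
      ∀ n : ℤ, Φ (g ^ n • p₀) = (κ (ZMod.toAddCircle ((n : ZMod N) * ξ)) : ℂ) *
        ((AddCircle.toCircle (((s * ((((n : ZMod N) * ξ).valMinAbs : ℝ) / N) : ℝ)) :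
          AddCircle (1 : ℝ)) : Circle) : ℂ) := by
  obtain ⟨Φ, g, p₀, hb, hL, horb⟩ := exists_circle_realisation
    (AddCircle.liftIoc 1 (-(1 / 2)) (fun y : ℝ => (κ (y : AddCircle (1 : ℝ)) : ℂ) *
        ((AddCircle.toCircle ((s * y : ℝ) : AddCircle (1 : ℝ)) : Circle) : ℂ)))
    (M := Lκ + 2 * Real.pi * |s| + 2 / (1 / 2 - r₂)) (norm_bracketLinear_le s hκ)
    (norm_bracketLinear_sub_le s hr hκ hκ0 hκL hLκ) ((ξ.valMinAbs : ℝ) / N) 0 h12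
  refine ⟨Φ, g, p₀, hb, hL, fun n => ?_⟩
  rw [horb n, ← toAddCircle_intMul_eq, toAddCircle_eq_coe_valMinAbs_div,
    bracketLinear_coe s hr.le hκ0 (abs_valMinAbs_div_le _)]

/-- **The quadratic bracket factor `χ(ξ·n)χ(ξ'·n) e(s{ξ·n}{ξ'·n})`** as a torus nilsequence:
`Φ(gⁿp) = κ(toAddCircle(nξ)) κ(toAddCircle(nξ')) e(s · valMinAbs(nξ)/N · valMinAbs(nξ')/N)`,
`Φ` `1`-bounded and `2(L_κ + 2π|s| + 2/(½−r₂))`-Lipschitz for the max metric.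
[cite: GreenTao2008U3Inverse, §12, Lemma 69] -/
theorem exists_quad_factor (hr : r₂ < 1 / 2) (hκ : ∀ a, 0 ≤ κ a ∧ κ a ≤ 1)
    (hκ0 : ∀ a, r₂ ≤ ‖a‖ → κ a = 0) (hκL : ∀ a b, |κ a - κ b| ≤ Lκ * dist a b) (hLκ : 0 ≤ Lκ)
    (ξ ξ' : ZMod N) (s : ℝ) (h12 : 1 ≤ 2) :
    ∃ (Φ : ((Nilmanifold.circle.ofLE h12).prod (Nilmanifold.circle.ofLE h12)).G ⧸
          ((Nilmanifold.circle.ofLE h12).prod (Nilmanifold.circle.ofLE h12)).Γ → ℂ)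
      (g : ((Nilmanifold.circle.ofLE h12).prod (Nilmanifold.circle.ofLE h12)).G)
      (p₀ : ((Nilmanifold.circle.ofLE h12).prod (Nilmanifold.circle.ofLE h12)).G ⧸
          ((Nilmanifold.circle.ofLE h12).prod (Nilmanifold.circle.ofLE h12)).Γ),
      (∀ y, ‖Φ y‖ ≤ 1) ∧
      (∀ y z, ‖Φ y - Φ z‖ ≤ (2 * (Lκ + 2 * Real.pi * |s| + 2 / (1 / 2 - r₂))) *
        ((Nilmanifold.circle.ofLE h12).prod (Nilmanifold.circle.ofLE h12)).dist y z) ∧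
      ∀ n : ℤ, Φ (g ^ n • p₀) =
        (κ (ZMod.toAddCircle ((n : ZMod N) * ξ)) : ℂ) *
          ((κ (ZMod.toAddCircle ((n : ZMod N) * ξ')) : ℂ) *
            ((AddCircle.toCircle (((s * ((((n : ZMod N) * ξ).valMinAbs : ℝ) / N) *
              ((((n : ZMod N) * ξ').valMinAbs : ℝ) / N) : ℝ)) : AddCircle (1 : ℝ)) :
                Circle) : ℂ)) := by
  obtain ⟨hbΨ, -, -, hLΨ⟩ := bracketQuad_bounds s hr hκ hκ0 hκL hLκ
  obtain ⟨Φ, g, p₀, hb, hL, horb⟩ := exists_torus_realisation _ hbΨ hLΨ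
    ((ξ.valMinAbs : ℝ) / N) ((ξ'.valMinAbs : ℝ) / N) 0 0 h12
  refine ⟨Φ, g, p₀, hb, hL, fun n => ?_⟩
  rw [horb n, ← toAddCircle_intMul_eq, ← toAddCircle_intMul_eq, toAddCircle_eq_coe_valMinAbs_div,
    toAddCircle_eq_coe_valMinAbs_div]
  exact bracketQuad_coe s hr.le hκ0 (abs_valMinAbs_div_le _) (abs_valMinAbs_div_le _)

end Circle

/-- **The Heisenberg bracket factor `χ(αn) e(P(n) − c·n·[αn])`** read on `ℤ/Nℤ` (`N` odd,
`α = valMinAbs ξ / N`, `[αn] = round(nα)`): over every `heisenbergWith d h` with `ρ₀ ≤ L·d`,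
`Φ(gⁿx₀) = κ(toAddCircle(nξ)) · e(z₀ + n(β + c/2 − cα/2) + n²(cα/2) − c·n·round(nα))`, `Φ`
`1`-bounded and `(4π + L_κ + 2/(½−r₂))·L`-Lipschitz. [cite: GreenTao2008U3Inverse, §12, Lemma 69] -/
theorem exists_heis_factor (d : HX → HX → ℝ) (h : IsCompatMetric d) {L : ℝ}
    (hcomp : ∀ p q, heisPreDist p q ≤ L * d p q ∧ d p q ≤ L * heisPreDist p q)
    {κ : AddCircle (1 : ℝ) → ℝ} {r₂ Lκ : ℝ} (hr : r₂ < 1 / 2) (hκ : ∀ a, 0 ≤ κ a ∧ κ a ≤ 1)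
    (hκ0 : ∀ a, r₂ ≤ ‖a‖ → κ a = 0) (hκL : ∀ a b, |κ a - κ b| ≤ Lκ * dist a b) (hLκ : 0 ≤ Lκ)
    {N : ℕ} [NeZero N] (ξ : ZMod N) (c β z₀ : ℝ) :
    ∃ (Φ : (heisenbergWith d h).G ⧸ (heisenbergWith d h).Γ → ℂ) (g : (heisenbergWith d h).G)
      (x₀ : (heisenbergWith d h).G ⧸ (heisenbergWith d h).Γ),
      (∀ y, ‖Φ y‖ ≤ 1) ∧
      (∀ y z, ‖Φ y - Φ z‖ ≤ ((4 * Real.pi + Lκ + 2 / (1 / 2 - r₂)) * L) * (heisenbergWith d h).dist y z) ∧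
      ∀ n : ℤ, Φ (g ^ n • x₀) =
        (κ (ZMod.toAddCircle ((n : ZMod N) * ξ)) : ℂ) *
          ((AddCircle.toCircle (((z₀ + n * (β + c / 2 - c * ((ξ.valMinAbs : ℝ) / N) / 2) +
              (n : ℝ) ^ 2 * (c * ((ξ.valMinAbs : ℝ) / N) / 2) -
              c * n * round ((n : ℝ) * ((ξ.valMinAbs : ℝ) / N)) : ℝ)) : AddCircle (1 : ℝ)) :
                Circle) : ℂ) := by
  obtain ⟨Φ, g, x₀, hb, hL, horb⟩ := exists_heisenberg_bracket d h hcomp hr hκ hκ0 hκL hLκ c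
    ((ξ.valMinAbs : ℝ) / N) β z₀
  refine ⟨Φ, g, x₀, hb, hL, fun n => ?_⟩
  rw [horb n, round_eq_floor_add_half, toAddCircle_intMul_eq, zero_add]

end Summit.Parity.GeneralizedHardyLittlewood.GreenTaoLevelTwoGITwoCyclicInverse
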